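import Summits.AtomisticToContinuum.BoseEinsteinCondensation.Theses.BECHardSphereReduction

/-!
# Line `coupling-ray` — crux `HardCoreDominates` (stmt-AtomisticToContinuum-11884) of route
# `BECHardSphereReduction` — ALTERNATIVE line (crux-strategist s2, 2026-08-17); registered with `--alt`,
# it does NOT replace the lead's skeleton of record `Lines/birth.lean` (one open stub `stub_diniSign`).

The path.  Fix `v` (measurable radial profile, `v r = 0` for `r > R`).  `birth` raises a FLAT STEP on the
whole range (`v + t·1_{Iic R}`, direction `U = 1_{Iic R}` independent of `v`); `core-growth` grows a HARD
BALL inside `v`.  Here the potential is SCALED AS A WHOLE: the global-coupling ray `c ↦ c·w` (`c ≥ 1`), the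
classical "coupling constant" of the Bose gas (`v ↦ λv`, LSSY2005 App. A p. 142) — equivalently, by
`H = −Δ + c·w = c·(−c⁻¹Δ + w)`, the MASS ray `m ↦ −(1/2m)Δ + w` ("heavier bosons condense less").
Because the direction of the perturbation IS the potential, the first-order response of the
depletion is a SUM OF SQUARES at every perturbative order in hand: Born level at `N = 2`
(`d/dc (1 − n₀/2) = ½ L⁻⁶ Σ_{k≠0} |ŵ(k)|²/k⁴ ≥ 0` at EVERY `L/R`, lead c3's PSD kernel `G₂` evaluated on the
diagonal) and Bogoliubov level at every `N` (`Σ_k ρ² ŵ(k)² k²/(2E_k³) ≥ 0` mode by mode, `E_k = (k⁴+2ρŵ(k)k²)^{1/2}`),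
whereas `birth`'s direction `U ≠ w` has the indefinite cross term `Σ ŵ(k)Û(k)/k⁴` whose UV band is where the
lead's numerics found the only violation (cavity shell against the ball, `L/R ≈ 2`).  By the virial identity
`c·⟨wΨ, R_⊥ n̂_φ Ψ⟩ = −⟨TΨ, R_⊥ n̂_φ Ψ⟩` (`T = −Δ`, `R_⊥Ψ = 0`) the exact sign content of stub A is a static
cross-susceptibility of TWO ONE-BODY observables (kinetic energy and condensate occupation), not of the
two-body overlap `W_R` against `n̂_φ`.

The ray from `v` ends at the hard wall on the support of `v`, which is `HS_R` only when `v > 0` a.e. on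
`[0, R]`; the line therefore runs the ray from the base points `v_ε := v + ε·1_{Iic R}` (`ε > 0`, full
support, still of range `R`), whose scaled limit `c·v_ε ≥ cε·1_{Iic R} → HS_R` is the crux's hard sphere for
EVERY `v`, and returns to `v` as `ε → 0⁺` by upper semicontinuity (a regularity statement with no sign content).

* `stub_globalCouplingAntitone` (stub A, XL — the physics): for every range `R > 0` there is ONE dilute
  window `N·R³ ≤ η₀(R)·L³` such that for every measurable radial `w` vanishing beyond `R`, every `(N, L)` in
  the window and every `c ≥ 1`, `condensateNumber (c·w) N L ≤ condensateNumber w N L` ("scaling up a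
  repulsive finite-range pair potential never raises the ground-state condensate"; the window is uniform
  in `w` — after the proved scale covariance `condensateNumber_dilate` an absolute constant — because it is
  applied along the family `v_ε`).
* `stub_scaledCutToHardCore` (stub B, M — functional analysis at fixed `N, L`, window-free): for `ε > 0`,
  `condensateNumber HS_R N L ≤ liminf_{c→∞} condensateNumber (c·v_ε) N L`.  Clone of the LANDED
  `condensateNumber_hardSphere_le_liminf` (p151033: Rellich p146938 + hard-sphere closed energy p147861 +
  cut p149338 + `λ_max` stability p144560) with the family `c ↦ c·v_ε` in place of `t ↦ v + t·1_{Iic R}`: the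
  two inputs of the cut hold verbatim (`c·v_ε ≤ HS_R` pointwise since `v_ε` vanishes beyond `R`; core mass
  `cε·∫_{K_R}|Ψ|² ≤ energy (c·v_ε) Ψ`).
* `stub_smallStepUSC` (stub C, L — regularity at the base point, dilute window): `∀ η > 0 ∃ ε₀ > 0
  ∀ 0 < ε ≤ ε₀, condensateNumber v_ε N L ≤ condensateNumber v N L + η`.  Mechanism: for finite `v` the
  Dirichlet ground state of `H_v` on the connected box is simple (Perron–Frobenius), ground states of
  `H_v + εW_R` (`0 ≤ W_R ≤ N(N−1)/2` bounded) converge to it in `L²` (compact resolvent), and `λ_max(γ)` is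
  `L²`-Lipschitz (p144560); for `v` with hard parts the dilute guard keeps the unconfined sector the gapped
  ground sector (trapped pair `≥ 2π²/R²` against insertion `O(ρR)` by Hoffmann-Ostenhof deletion + Dyson–
  Jastrow insertion + packing), where the same argument runs componentwise.  It is the `ε → 0⁺` twin of
  `core-growth`'s `stub_vanishingCoreUSC` (bounded perturbation instead of a capacity-zero one: easier).
* `HardCoreDominates_of (hA hB hC) : HardCoreDominates` sorry-free: `η₀ := min η₀^A(R) η₀^C(v,R)`; for
  `(N, L)` in the window and `η > 0` take `ε := ε₀(η)`; then
  `cn(HS_R) ≤ liminf_c cn(c·v_ε) ≤ cn(v_ε) ≤ cn(v) + η` (B, then A at `w := v_ε` for all `c ≥ 1`, then C),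
  and `η → 0⁺` (`ENNReal.le_of_forall_pos_le_add`).

Why it dodges the live line's STUCK goal (`stub_diniSign`: `D⁺_t cn(v + t·1_{Iic R}) ≤ 0` at every `t`): the
lead's c2/c3 memos localise the difficulty of that sign in the MISALIGNMENT of the background `v_t` and the
direction `1_{Iic R}` (time-integrated covariance kernel `G₂ ∝ 1/k⁴`, contact part `−|x−y|/8π` of the wrong
sign; Born-level universality only for `L/R ≳ 50`; the one numerical violation is a cavity shell against the
ball).  Along the coupling ray direction = background, the Born and Bogoliubov responses are sums of squares
with NO alignment condition and no `L/R` threshold, so the residual content of stub A is exactly the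
non-perturbative control common to every line (no shape competition left to fight); and its exact form is a
one-body/one-body susceptibility (`T` against `n̂_φ`), the object with the most structure (f-sum-rule type
identities, PSD on the diagonal).  Stubs B and C are provable now (B is a clone of landed theorems).

Disproof used: no `Cruxes/HardCoreDominates/Disproof.lean` exists (checked 2026-08-17T14:35Z, `ledger crux ls`).
Checked against the sibling's landed negatives `Theorems/HardCoreExtension/Negative/HighDensityObstruction.lean`:
`not_condensateNumber_mono_potential` refutes the OPPOSITE direction (`v ≤ w ⇒ cn v ≤ cn w`, free gas vs packed
hard core) — stub A runs downward in `cn` and carries the dilute guard (packed corners read `0 ≤ …` or `⊤ ≤ ⊤`);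
`Cruxes/HardCoreExtension/Disproof.lean` §7 (`not_monotoneLimitTransfer`: fixed-box usc fails for hard shells
TUNED to an in/out degeneracy at `ρR³ ≈ 0.4`) — stub C carries the dilute guard, and a tuned degeneracy needs a
trapped pair (`≥ 2π²/R²`) to tie with the unconfined sector (`O(ρR)` per particle), impossible for `ρR³ ≤ η₀`
small, uniformly in `N` and in the (non-negative) profile.
-/

namespace Summit.AtomisticToContinuum.BoseEinsteinCondensation.Cruxes.HardCoreDominates.CouplingRay

open Literature.MathematicalPhysics.QuantumManyBody.BoseGas

/-! ## Audit names of the stub statements (hypotheses of the glue theorem BY NAME) -/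

namespace Goal

/-- Statement of stub A `stub_globalCouplingAntitone` (verbatim). -/
abbrev stub_globalCouplingAntitone : Prop :=
  ∀ R : ℝ, 0 < R → ∃ η₀ : ℝ, 0 < η₀ ∧
    ∀ (w : ℝ → ENNReal), Measurable w → (∀ r : ℝ, R < r → w r = 0) →
      ∀ (N : ℕ) (L : ℝ), (N : ℝ) * R ^ 3 ≤ η₀ * L ^ 3 → ∀ c : NNReal, 1 ≤ c →
        Literature.MathematicalPhysics.QuantumManyBody.BoseGas.condensateNumber
            (fun r : ℝ => ((c : NNReal) : ENNReal) * w r) N L ≤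
          Literature.MathematicalPhysics.QuantumManyBody.BoseGas.condensateNumber w N L

/-- Statement of stub B `stub_scaledCutToHardCore` (verbatim). -/
abbrev stub_scaledCutToHardCore : Prop :=
  ∀ (v : ℝ → ENNReal) (R : ℝ), Measurable v → 0 < R → (∀ r : ℝ, R < r → v r = 0) →
    ∀ ε : NNReal, 0 < ε → ∀ (N : ℕ) (L : ℝ),
      Literature.MathematicalPhysics.QuantumManyBody.BoseGas.condensateNumber
          (Set.indicator (Set.Iic R) (fun _ : ℝ => (⊤ : ENNReal))) N L ≤
        Filter.liminf (fun c : NNReal =>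
          Literature.MathematicalPhysics.QuantumManyBody.BoseGas.condensateNumber
            (fun r : ℝ => ((c : NNReal) : ENNReal) *
              (v + Set.indicator (Set.Iic R) (fun _ : ℝ => ((ε : NNReal) : ENNReal))) r) N L)
          Filter.atTop

/-- Statement of stub C `stub_smallStepUSC` (verbatim). -/
abbrev stub_smallStepUSC : Prop :=
  ∀ (v : ℝ → ENNReal) (R : ℝ), Measurable v → 0 < R → (∀ r : ℝ, R < r → v r = 0) →
    ∃ η₀ : ℝ, 0 < η₀ ∧ ∀ (N : ℕ) (L : ℝ), (N : ℝ) * R ^ 3 ≤ η₀ * L ^ 3 →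
      ∀ η : NNReal, 0 < η → ∃ ε₀ : NNReal, 0 < ε₀ ∧ ∀ ε : NNReal, 0 < ε → ε ≤ ε₀ →
        Literature.MathematicalPhysics.QuantumManyBody.BoseGas.condensateNumber
            (v + Set.indicator (Set.Iic R) (fun _ : ℝ => ((ε : NNReal) : ENNReal))) N L ≤
          Literature.MathematicalPhysics.QuantumManyBody.BoseGas.condensateNumber v N L +
            ((η : NNReal) : ENNReal)

end Goal

/-! ## The registered stubs (the only `sorry`s of this file) -/

/-- **stub A — GlobalCouplingAntitone (XL, the physics).** For every range `R > 0` there is a dilute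
window `N·R³ ≤ η₀(R)·L³`, uniform in the profile, in which scaling a measurable radial profile `w`
(vanishing beyond `R`) by a factor `c ≥ 1` never raises the ground-state condensate number:
`condensateNumber (c·w) N L ≤ condensateNumber w N L`.  Equivalently (virial identity) the static
cross-susceptibility of kinetic energy and condensate occupation in the ground state of `−Δ + w` is signed;
perturbatively a sum of squares at Born (`Σ|ŵ(k)|²/k⁴`) and Bogoliubov (`Σ ρ²ŵ(k)²k²/(2E_k³)`) level, every
`N`, every `L/R`.  Edge cases are equalities (`N ≤ 1`; empty trial class `⊤ ≤ ⊤`); `c·⊤ = ⊤` keeps hard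
parts of `w` fixed; the guard excludes packed / tuned-degenerate boxes (sibling Disproof §7). -/
theorem stub_globalCouplingAntitone :
    ∀ R : ℝ, 0 < R → ∃ η₀ : ℝ, 0 < η₀ ∧
      ∀ (w : ℝ → ENNReal), Measurable w → (∀ r : ℝ, R < r → w r = 0) →
        ∀ (N : ℕ) (L : ℝ), (N : ℝ) * R ^ 3 ≤ η₀ * L ^ 3 → ∀ c : NNReal, 1 ≤ c →
          Literature.MathematicalPhysics.QuantumManyBody.BoseGas.condensateNumber
              (fun r : ℝ => ((c : NNReal) : ENNReal) * w r) N L ≤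
            Literature.MathematicalPhysics.QuantumManyBody.BoseGas.condensateNumber w N L := by
  sorry

/-- **stub B — ScaledCutToHardCore (M, functional analysis at fixed `N, L`; no window).** For every
`ε > 0` the hard-sphere condensate number is at most the `liminf`, along the global-coupling ray
`c → ∞`, of the condensate numbers of `c·(v + ε·1_{Iic R})`:  near-minimisers of `c·v_ε` for large `c`
carry core mass `≤ energy/(cε) → 0`, so (Rellich in the box, hard-sphere closed energy = minimal form,
`λ_max` `L²`-Lipschitz) they are `L²`-close to hard-sphere near-minimisers of any prescribed slack —
verbatim the landed cut of line `birth` (p146938 p147861 p149338 p144560 p151033) with the family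
`c ↦ c·v_ε` (`≤ HS_R` pointwise) replacing `t ↦ v + t·1_{Iic R}`. [folklore] -/
theorem stub_scaledCutToHardCore :
    ∀ (v : ℝ → ENNReal) (R : ℝ), Measurable v → 0 < R → (∀ r : ℝ, R < r → v r = 0) →
      ∀ ε : NNReal, 0 < ε → ∀ (N : ℕ) (L : ℝ),
        Literature.MathematicalPhysics.QuantumManyBody.BoseGas.condensateNumber
            (Set.indicator (Set.Iic R) (fun _ : ℝ => (⊤ : ENNReal))) N L ≤
          Filter.liminf (fun c : NNReal =>
            Literature.MathematicalPhysics.QuantumManyBody.BoseGas.condensateNumber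
              (fun r : ℝ => ((c : NNReal) : ENNReal) *
                (v + Set.indicator (Set.Iic R) (fun _ : ℝ => ((ε : NNReal) : ENNReal))) r) N L)
            Filter.atTop := by
  sorry

/-- **stub C — SmallStepUSC (L, regularity at the base point, dilute window).** For every measurable
radial `v` vanishing beyond `R > 0` there is a dilute window in which, at each `(N, L)`, adding a SMALL
flat step `ε·1_{Iic R}` raises the ground-state condensate number by at most `η`, for every `η > 0` and
all `0 < ε ≤ ε₀(η)`: upper semicontinuity of `ε ↦ cn(v + ε·1_{Iic R})` at `0⁺` — no sign content (the lower
semicontinuity is the landed `stub_pathLsc`, p154150).  Mechanism: simple positive ground state of `H_v`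
(Perron–Frobenius) for finite `v`; for `v` with hard parts the unconfined sector is the gapped ground
sector in the window (trapped pair `≥ 2π²/R²` vs insertion `O(ρR)`), and `λ_max(γ)` is `L²`-Lipschitz
(p144560). [folklore] -/
theorem stub_smallStepUSC :
    ∀ (v : ℝ → ENNReal) (R : ℝ), Measurable v → 0 < R → (∀ r : ℝ, R < r → v r = 0) →
      ∃ η₀ : ℝ, 0 < η₀ ∧ ∀ (N : ℕ) (L : ℝ), (N : ℝ) * R ^ 3 ≤ η₀ * L ^ 3 →
        ∀ η : NNReal, 0 < η → ∃ ε₀ : NNReal, 0 < ε₀ ∧ ∀ ε : NNReal, 0 < ε → ε ≤ ε₀ →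
          Literature.MathematicalPhysics.QuantumManyBody.BoseGas.condensateNumber
              (v + Set.indicator (Set.Iic R) (fun _ : ℝ => ((ε : NNReal) : ENNReal))) N L ≤
            Literature.MathematicalPhysics.QuantumManyBody.BoseGas.condensateNumber v N L +
              ((η : NNReal) : ENNReal) := by
  sorry

/-! ## Composition (sorry-free): the crux BY NAME from the three stubs -/

/-- The base points `v_ε := v + ε·1_{Iic R}` are measurable radial profiles of range `R`. [folklore] -/
theorem step_measurable {v : ℝ → ENNReal} (hmeas : Measurable v) (R : ℝ) (ε : NNReal) :
    Measurable (v + Set.indicator (Set.Iic R) (fun _ : ℝ => ((ε : NNReal) : ENNReal))) :=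
  hmeas.add (measurable_const.indicator measurableSet_Iic)

/-- … and vanish beyond `R`. [folklore] -/
theorem step_range {v : ℝ → ENNReal} {R : ℝ} (hvR : ∀ r : ℝ, R < r → v r = 0) (ε : NNReal) :
    ∀ r : ℝ, R < r → (v + Set.indicator (Set.Iic R) (fun _ : ℝ => ((ε : NNReal) : ENNReal))) r = 0 := by
  intro r hr
  have hr' : r ∉ Set.Iic R := fun h => (not_le.2 hr) h
  simp [Pi.add_apply, hvR r hr, Set.indicator_of_notMem hr']

/-- **Assembly of the line**: `HardCoreDominates` from stubs A, B, C (hypotheses by their audit names).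
With `η₀ := min η₀^A(R) η₀^C(v,R)`, for `(N, L)` in the window and every `η > 0` (with `ε := ε₀(η)` from C):
`cn(HS_R) ≤ liminf_c cn(c·v_ε) ≤ cn(v_ε) ≤ cn(v) + η`, then `η → 0⁺`. [folklore] -/
theorem HardCoreDominates_of (hA : Goal.stub_globalCouplingAntitone) (hB : Goal.stub_scaledCutToHardCore)
    (hC : Goal.stub_smallStepUSC) :
    Summit.AtomisticToContinuum.BoseEinsteinCondensation.Theses.BECHardSphereReduction.HardCoreDominates := by
  intro v R hmeas hR hvR
  obtain ⟨η₁, hη₁, hanti⟩ := hA R hR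
  obtain ⟨η₂, hη₂, husc⟩ := hC v R hmeas hR hvR
  refine ⟨min η₁ η₂, lt_min hη₁ hη₂, fun N L hNL => ?_⟩
  -- the guard forces `0 ≤ L ^ 3`, so the window `min η₁ η₂` lies inside both windows
  have hL3 : 0 ≤ L ^ 3 := by
    by_contra hneg
    push Not at hneg
    have hlt : (N : ℝ) * R ^ 3 < 0 :=
      hNL.trans_lt (mul_neg_of_pos_of_neg (lt_min hη₁ hη₂) hneg)
    exact absurd hlt (not_lt.2 (by positivity))
  have hN₁ : (N : ℝ) * R ^ 3 ≤ η₁ * L ^ 3 :=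
    hNL.trans (mul_le_mul_of_nonneg_right (min_le_left _ _) hL3)
  have hN₂ : (N : ℝ) * R ^ 3 ≤ η₂ * L ^ 3 :=
    hNL.trans (mul_le_mul_of_nonneg_right (min_le_right _ _) hL3)
  -- `cn(HS_R) ≤ cn(v) + η` for every `η > 0`
  refine ENNReal.le_of_forall_pos_le_add fun η hη _ => ?_
  obtain ⟨ε₀, hε₀, hstep⟩ := husc N L hN₂ η hη
  calc Literature.MathematicalPhysics.QuantumManyBody.BoseGas.condensateNumber
          (Set.indicator (Set.Iic R) (fun _ : ℝ => (⊤ : ENNReal))) N L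
        ≤ Filter.liminf (fun c : NNReal =>
            Literature.MathematicalPhysics.QuantumManyBody.BoseGas.condensateNumber
              (fun r : ℝ => ((c : NNReal) : ENNReal) *
                (v + Set.indicator (Set.Iic R) (fun _ : ℝ => ((ε₀ : NNReal) : ENNReal))) r) N L)
            Filter.atTop := hB v R hmeas hR hvR ε₀ hε₀ N L
    _ ≤ Literature.MathematicalPhysics.QuantumManyBody.BoseGas.condensateNumber
            (v + Set.indicator (Set.Iic R) (fun _ : ℝ => ((ε₀ : NNReal) : ENNReal))) N L := by
          refine Filter.liminf_le_of_frequently_le' (Filter.Eventually.frequently ?_)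
          exact Filter.eventually_atTop.2 ⟨1, fun c hc =>
            hanti _ (step_measurable hmeas R ε₀) (step_range hvR ε₀) N L hN₁ c hc⟩
    _ ≤ Literature.MathematicalPhysics.QuantumManyBody.BoseGas.condensateNumber v N L + η :=
          hstep ε₀ hε₀ le_rfl

/-- **The skeleton applied to the (sorried) stubs**: `HardCoreDominates` modulo exactly
`stub_globalCouplingAntitone`, `stub_scaledCutToHardCore`, `stub_smallStepUSC`. -/
theorem HardCoreDominates_proof :
    Summit.AtomisticToContinuum.BoseEinsteinCondensation.Theses.BECHardSphereReduction.HardCoreDominates :=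
  HardCoreDominates_of stub_globalCouplingAntitone stub_scaledCutToHardCore stub_smallStepUSC

/-! ## Documentation (sorry-free modulo stub A): the free-background instance of stub A is the
coupling monotonicity of line `birth` at `v = 0` (the pure flat-step ray `t ↦ t·1_{Iic R}` IS a global ray) -/

/-- **Stub A at `w := s·1_{Iic R}` orders the pure flat-step ray**: in stub A's window,
`0 < s ≤ t ⇒ cn(t·1_{Iic R}) ≤ cn(s·1_{Iic R})` — the `v = 0` instance of `birth`'s v5 stub
`stub_covarianceSign` (there for all `s ≥ 0`; `s = 0` is the free gas, `cn = N`). [folklore] -/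
theorem flatStep_antitone_of (hA : Goal.stub_globalCouplingAntitone) :
    ∀ R : ℝ, 0 < R → ∃ η₀ : ℝ, 0 < η₀ ∧ ∀ (N : ℕ) (L : ℝ), (N : ℝ) * R ^ 3 ≤ η₀ * L ^ 3 →
      ∀ s t : NNReal, 0 < s → s ≤ t →
        Literature.MathematicalPhysics.QuantumManyBody.BoseGas.condensateNumber
            (Set.indicator (Set.Iic R) (fun _ : ℝ => ((t : NNReal) : ENNReal))) N L ≤
          Literature.MathematicalPhysics.QuantumManyBody.BoseGas.condensateNumber
            (Set.indicator (Set.Iic R) (fun _ : ℝ => ((s : NNReal) : ENNReal))) N L := by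
  intro R hR
  obtain ⟨η₀, hη₀, h⟩ := hA R hR
  refine ⟨η₀, hη₀, fun N L hNL s t hs hst => ?_⟩
  have hmeas : Measurable (Set.indicator (Set.Iic R) (fun _ : ℝ => ((s : NNReal) : ENNReal))) :=
    measurable_const.indicator measurableSet_Iic
  have hrange : ∀ r : ℝ, R < r → Set.indicator (Set.Iic R) (fun _ : ℝ => ((s : NNReal) : ENNReal)) r = 0 := by
    intro r hr
    have hr' : r ∉ Set.Iic R := fun hle => (not_le.2 hr) hle
    exact Set.indicator_of_notMem hr' _
  have hc : (1 : NNReal) ≤ t / s := by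
    rw [le_div_iff₀ hs, one_mul]
    exact hst
  have key := h _ hmeas hrange N L hNL (t / s) hc
  have hfun : (fun r : ℝ => (((t / s : NNReal)) : ENNReal) *
      Set.indicator (Set.Iic R) (fun _ : ℝ => ((s : NNReal) : ENNReal)) r) =
      Set.indicator (Set.Iic R) (fun _ : ℝ => ((t : NNReal) : ENNReal)) := by
    funext r
    by_cases hr : r ∈ Set.Iic R
    · rw [Set.indicator_of_mem hr, Set.indicator_of_mem hr, ← ENNReal.coe_mul,
        div_mul_cancel₀ t hs.ne']
    · rw [Set.indicator_of_notMem hr, Set.indicator_of_notMem hr, mul_zero]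
  rw [hfun] at key
  exact key

end Summit.AtomisticToContinuum.BoseEinsteinCondensation.Cruxes.HardCoreDominates.CouplingRay
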